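import Literature.RingTheory.SimpleModule.WedderburnArtinUniquenessSemisimple
import Mathlib.RingTheory.SimpleModule.WedderburnArtin
import Mathlib.RingTheory.SimpleRing.Matrix
import Mathlib.Algebra.Algebra.Subalgebra.Centralizer
import Mathlib.RingTheory.TensorProduct.Basic
import HarnessLib

/-!
# The centre of a homomorphic image of a semisimple ring, and the centre of a base change

Topic `RingTheory/SimpleModule`; namespace `Literature.RingTheory.SimpleModule`.  THEOREMS ONLY (no definition, no named fact,
no instance, no `sorry`); Mathlib + ★ `WedderburnArtinUniquenessSemisimple` only.

Print / folklore. [Lam2001FirstCourse] §3 Lemma (3.8) (p. 35) and the remark on simple components before (3.9) (p. 36): a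
two-sided ideal of a semisimple ring `R = B_1 ⊕ ⋯ ⊕ B_r` is a sum of simple components, so every quotient of `R` is
`≅ ⊕_{i ∈ J} B_i` and ITS CENTRE IS THE IMAGE OF THE CENTRE `Z(R) = ⊕ Z(B_i)`; [Lam2001FirstCourse] §22 Prop. (22.1)
(p. 327) for the central idempotents.  For the base change, Mathlib's `Subalgebra.centralizer_range_includeRight_eq_center_tensorProduct`
(«the centralizer of `1 ⊗ B` in `A ⊗ B` is `A ⊗ Z(B)`», [BourbakiAlgebreVIII2012]-style) gives at once: the centre of
`L ⊗_K H` (`L` commutative) lies in `L ⊗_K Z(H)`.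

This is the glue (G-ii) of the cell `hodgecm-mathlib` d6 S2′ binder `hIsoSpan`: it discharges the hypothesis `hZ` («every
central `z` with `z ε = z` lies in the `L`-span of `Z₀`») of ★ `CentralCharacterIsotypic.mem_isotypicComponent_of_forall_smul_eq`
for the IMAGE `R′ = Φ(L ⊗_K H)` of a base-changed algebra (e.g. `adjoin_L {Hecke operators} ⊆ End_L V`) from the same
statement inside `H` (the block field `Z(H)·ε`, ★ `PositiveInvolutionCentreBlockField.exists_centreBlockField`).

* §1 `exists_central_preimage_of_surjective` — `S` semisimple, `Φ : S →+* R′` surjective: every central `z′ ∈ R′` has a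
  CENTRAL preimage.  (Wedderburn–Artin `e : S ≅ Π A_i`, `A_i` simple; the kernel is a two-sided ideal, hence «contains
  `ε_i` or has zero `i`-th coordinate» (★ `symm_single_one_mem_of_mem`); for any preimage `t`, `u t` with
  `u = Σ_{ε_i ∉ ker} ε_i` is central and still a preimage.)
* §2 `mem_range_map_center_of_forall_comm` — `L` commutative and free over `K`: a central element of `L ⊗_K H` lies in
  the range of `L ⊗_K Z(H) → L ⊗_K H`; `mul_tmul_mem_span_of_forall_comm` — if every central `c ∈ H` has
  `c ε ∈ span_K Z₀`, then `z (1 ⊗ ε) ∈ span_L {1 ⊗ y | y ∈ Z₀}` for every central `z`.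
* §3 `mem_span_image_of_forall_comm_of_mul_eq` — the two combined through a surjective `L`-algebra map
  `Φ : L ⊗_K H →ₐ[L] R′` with `L ⊗_K H` semisimple: every central `z′ ∈ R′` with `z′ Φ(1 ⊗ ε) = z′` lies in
  `span_L (Φ '' {1 ⊗ y | y ∈ Z₀})` — literally the `hZ` of ★ `mem_isotypicComponent_of_forall_smul_eq` for `R′`.

Count-neutral support file (HC_CM is proved only modulo the 7 printed citations until rung 0 closes).

## References
* [Lam2001FirstCourse] T. Y. Lam, *A First Course in Noncommutative Rings*, 2nd ed., GTM 131 (2001): §3 Lemma (3.8) (p. 35) and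
  the discussion before (3.9) (p. 36); §22 Prop. (22.1) (p. 327).
-/

set_option autoImplicit false

open scoped TensorProduct

namespace Literature.RingTheory.SimpleModule

/-! ## §1 Central elements of a homomorphic image of a semisimple ring lift to central elements -/

section CentralLift

variable {S : Type*} [Ring S] {R' : Type*} [Ring R'] (Φ : S →+* R')

/-- Over `S ≅ A_1 × ⋯ × A_r` with `A_i` simple: if `t s - s t ∈ ker Φ` for all `s`, then `u t` is central, where
`u = Σ_{ε_i ∉ ker Φ} ε_i`, and `Φ (u t) = Φ t`. [cite: Lam2001FirstCourse, §3 Lemma (3.8) (p. 35) and before (3.9) (p. 36)] -/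
theorem exists_central_mul_of_forall_sub_mem_ker {ι : Type*} [Fintype ι] [DecidableEq ι] {A : ι → Type*}
    [∀ i, Ring (A i)] [∀ i, IsSimpleRing (A i)] (e : S ≃+* (Π i, A i)) (t : S)
    (ht : ∀ s : S, t * s - s * t ∈ RingHom.ker Φ) :
    ∃ t' : S, (∀ s : S, t' * s = s * t') ∧ Φ t' = Φ t := by
  classical
  -- the coordinates of `t` off the kernel blocks are central
  have hcoord : ∀ i, e.symm (Pi.single i 1) ∉ RingHom.ker Φ → ∀ a : A i, e t i * a = a * e t i := by
    intro i hi a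
    have hmem := ht (e.symm (Pi.single i a))
    have hzero : e (t * e.symm (Pi.single i a) - e.symm (Pi.single i a) * t) i = 0 := by
      by_contra hne
      exact hi (symm_single_one_mem_of_mem e hmem hne)
    rw [map_sub, map_mul, map_mul, e.apply_symm_apply, Pi.sub_apply, Pi.mul_apply, Pi.mul_apply,
      Pi.single_eq_same, sub_eq_zero] at hzero
    exact hzero
  -- the central modification `t' = e⁻¹ (coordinates of `t` off the kernel blocks, `0` on them)`
  refine ⟨e.symm (fun i => if e.symm (Pi.single i 1) ∈ RingHom.ker Φ then 0 else e t i), fun s => ?_, ?_⟩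
  · apply e.injective
    rw [map_mul, map_mul, e.apply_symm_apply]
    funext i
    rw [Pi.mul_apply, Pi.mul_apply]
    split_ifs with h
    · rw [zero_mul, mul_zero]
    · exact hcoord i h (e s i)
  · -- `Φ t' = Φ t`: the difference `t - t'` has coordinates only on kernel blocks, so lies in `ker Φ`
    have hdiff : t - e.symm (fun i => if e.symm (Pi.single i 1) ∈ RingHom.ker Φ then 0 else e t i) ∈ RingHom.ker Φ := by
      rw [mem_iff_forall_symm_single_one_mem e]
      intro i hi
      by_contra hni
      apply hi
      rw [map_sub, e.apply_symm_apply, Pi.sub_apply, if_neg hni, sub_self]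
    rw [RingHom.mem_ker, map_sub, sub_eq_zero] at hdiff
    exact hdiff.symm

/-- **Central lift.**  If `S` is a semisimple ring and `Φ : S →+* R′` is surjective, every central element of `R′` is the
image of a CENTRAL element of `S` (the centre of a homomorphic image of a semisimple ring is the image of the centre).
[cite: Lam2001FirstCourse, §3 Lemma (3.8) (p. 35) and before (3.9) (p. 36)] -/
theorem exists_central_preimage_of_surjective [IsSemisimpleRing S] (hΦ : Function.Surjective Φ) (z' : R')
    (hz' : ∀ r : R', z' * r = r * z') : ∃ t : S, (∀ s : S, t * s = s * t) ∧ Φ t = z' := by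
  classical
  obtain ⟨n, D, d, _, hd, ⟨e⟩⟩ := IsSemisimpleRing.exists_ringEquiv_pi_matrix_divisionRing S
  haveI : ∀ i, Nonempty (Fin (d i)) := fun i => ⟨⟨0, Nat.pos_of_ne_zero (NeZero.ne _)⟩⟩
  obtain ⟨t, rfl⟩ := hΦ z'
  have ht : ∀ s : S, t * s - s * t ∈ RingHom.ker Φ := fun s => by
    rw [RingHom.mem_ker, map_sub, map_mul, map_mul, hz' (Φ s), sub_self]
  exact exists_central_mul_of_forall_sub_mem_ker Φ e t ht

end CentralLift

/-! ## §2 The centre of a base change `L ⊗_K H` lies in `L ⊗_K Z(H)` -/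

section BaseChange

variable {K : Type*} [CommRing K] {L : Type*} [CommRing L] [Algebra K L] {H : Type*} [Ring H] [Algebra K H]

/-- A central element of `L ⊗_K H` (`L` commutative, free over `K`) lies in the range of `L ⊗_K Z(H) → L ⊗_K H`
(Mathlib: the centralizer of `1 ⊗ H` is `L ⊗ Z(H)`). [cite: Lam2001FirstCourse, §22 Prop. (22.1) (p. 327)] -/
theorem mem_range_map_center_of_forall_comm [Module.Free K L] (z : L ⊗[K] H) (hz : ∀ x : L ⊗[K] H, z * x = x * z) :
    z ∈ (Algebra.TensorProduct.map (AlgHom.id K L) (Subalgebra.center K H).val).range := by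
  rw [← Subalgebra.centralizer_range_includeRight_eq_center_tensorProduct]
  rw [Subalgebra.mem_centralizer_iff]
  intro g _
  exact (hz g).symm

/-- Hence, for a central `z` and any `ε ∈ H` such that every central `c ∈ H` has `c ε ∈ span_K Z₀` (e.g. `Z₀ = Z(H)·ε`):
`z (1 ⊗ ε) ∈ span_L {1 ⊗ y | y ∈ Z₀}`. [cite: Lam2001FirstCourse, §22 Prop. (22.1) (p. 327)] -/
theorem mul_tmul_mem_span_of_forall_comm [Module.Free K L] (Z₀ : Set H) (ε : H)
    (hZ₀ : ∀ c : H, (∀ y : H, c * y = y * c) → c * ε ∈ Submodule.span K Z₀)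
    (z : L ⊗[K] H) (hz : ∀ x : L ⊗[K] H, z * x = x * z) :
    z * ((1 : L) ⊗ₜ[K] ε) ∈ Submodule.span L ((fun y : H => (1 : L) ⊗ₜ[K] y) '' Z₀) := by
  obtain ⟨w, hw⟩ := mem_range_map_center_of_forall_comm z hz
  have key : ∀ w : L ⊗[K] ↥(Subalgebra.center K H),
      (Algebra.TensorProduct.map (AlgHom.id K L) (Subalgebra.center K H).val) w * ((1 : L) ⊗ₜ[K] ε) ∈
        Submodule.span L ((fun y : H => (1 : L) ⊗ₜ[K] y) '' Z₀) := by
    intro w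
    induction w using TensorProduct.induction_on with
    | zero => rw [map_zero, zero_mul]; exact Submodule.zero_mem _
    | tmul l c =>
      rw [Algebra.TensorProduct.map_tmul, AlgHom.id_apply, Subalgebra.coe_val, Algebra.TensorProduct.tmul_mul_tmul, mul_one]
      -- `c ε ∈ span_K Z₀`, so `l ⊗ (c ε) ∈ span_L {1 ⊗ y}`
      have hc : (c : H) * ε ∈ Submodule.span K Z₀ := hZ₀ c (fun y => (Subalgebra.mem_center_iff.1 c.2 y).symm)
      refine Submodule.span_induction (p := fun x _ => l ⊗ₜ[K] x ∈ Submodule.span L ((fun y : H => (1 : L) ⊗ₜ[K] y) '' Z₀))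
        ?_ ?_ ?_ ?_ hc
      · intro y hy
        have h1 : l ⊗ₜ[K] y = l • ((1 : L) ⊗ₜ[K] y) := by
          rw [TensorProduct.smul_tmul', smul_eq_mul, mul_one]
        rw [h1]
        exact Submodule.smul_mem _ l (Submodule.subset_span ⟨y, hy, rfl⟩)
      · rw [TensorProduct.tmul_zero]; exact Submodule.zero_mem _
      · intro x y _ _ hx hy
        rw [TensorProduct.tmul_add]; exact Submodule.add_mem _ hx hy
      · intro k x _ hx
        have h2 : l ⊗ₜ[K] (k • x) = algebraMap K L k • (l ⊗ₜ[K] x) := by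
          rw [algebraMap_smul, TensorProduct.smul_tmul', TensorProduct.smul_tmul]
        rw [h2]
        exact Submodule.smul_mem _ _ hx
    | add x y hx hy => rw [map_add, add_mul]; exact Submodule.add_mem _ hx hy
  have hw' : (Algebra.TensorProduct.map (AlgHom.id K L) (Subalgebra.center K H).val) w = z := hw
  rw [← hw']
  exact key w

end BaseChange

/-! ## §3 Through a surjection: the `hZ` hypothesis of `mem_isotypicComponent_of_forall_smul_eq` for an image algebra -/

section Image

variable {K : Type*} [CommRing K] {L : Type*} [CommRing L] [Algebra K L] {H : Type*} [Ring H] [Algebra K H]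
  {R' : Type*} [Ring R'] [Algebra L R']

/-- **The `hZ` discharge.**  Let `Φ : L ⊗_K H →ₐ[L] R′` be a surjective `L`-algebra map with `L ⊗_K H` semisimple, `ε ∈ H`,
and `Z₀ ⊆ H` such that every central `c ∈ H` has `c ε ∈ span_K Z₀` (e.g. `Z₀ = Z(H)·ε`).  Then every CENTRAL `z′ ∈ R′` with
`z′ Φ(1 ⊗ ε) = z′` lies in `span_L (Φ '' {1 ⊗ y | y ∈ Z₀})`.  (Central lift §1, then §2, then push forward along `Φ`.)
[cite: Lam2001FirstCourse, §3 Lemma (3.8) (p. 35) and before (3.9) (p. 36), §22 Prop. (22.1) (p. 327)] -/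
theorem mem_span_image_of_forall_comm_of_mul_eq [IsSemisimpleRing (L ⊗[K] H)] [Module.Free K L]
    (Φ : L ⊗[K] H →ₐ[L] R') (hΦ : Function.Surjective Φ) (Z₀ : Set H) (ε : H)
    (hZ₀ : ∀ c : H, (∀ y : H, c * y = y * c) → c * ε ∈ Submodule.span K Z₀)
    (z' : R') (hz' : ∀ r : R', z' * r = r * z') (hz'ε : z' * Φ ((1 : L) ⊗ₜ[K] ε) = z') :
    z' ∈ Submodule.span L (Φ '' ((fun y : H => (1 : L) ⊗ₜ[K] y) '' Z₀)) := by
  obtain ⟨t, htc, htz⟩ := exists_central_preimage_of_surjective Φ.toRingHom hΦ z' hz'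
  have ht : z' = Φ (t * ((1 : L) ⊗ₜ[K] ε)) := by
    rw [map_mul, ← hz'ε]
    exact congrArg (· * Φ ((1 : L) ⊗ₜ[K] ε)) htz.symm
  have hle : Submodule.span L ((fun y : H => (1 : L) ⊗ₜ[K] y) '' Z₀) ≤
      (Submodule.span L (Φ '' ((fun y : H => (1 : L) ⊗ₜ[K] y) '' Z₀))).comap Φ.toLinearMap :=
    Submodule.span_le.2 fun x hx => Submodule.subset_span ⟨x, hx, rfl⟩
  rw [ht]
  exact hle (mul_tmul_mem_span_of_forall_comm Z₀ ε hZ₀ t htc)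

end Image

end Literature.RingTheory.SimpleModule
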